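/-
Copyright (c) 2026 The HCML crux team. All rights reserved.
Released under Apache 2.0 license as described in the file LICENSE.
Authors: K2E3-p11 (g6) (explicit-unit `hodgecm-mathlib-K2E3-p11-g6`; dealer K2E3-plan (g4) D73) — the `N = 2` twin, statement for statement, of ★ (B1) `K2E3GL3FinConjModCocompact` by K2E3-p23 (g5)
-/
import Summits.HodgeConjecture.HodgeConjecture.Theorems.K2E3GL3FinConjModCocompact        -- ★ (B1) p857737 + ED. 2 p857796 (K2E3-p23 (g5)): GENERIC §1 twisted commutants + §2 transfer lemmas, reused by import (not restated)
import Summits.HodgeConjecture.HodgeConjecture.Theorems.K2E3GL2ModCocompactUnimodular     -- ★ (2F-b′) p858798 (K2E5-p17 (g5)): `G_Λ` unimodular; brings ★ (2F-b) `K2E3GL2ModCocompactCentral` (`q_Λ`, `isHaarMeasure_map_quotMap`), ★ (2F-a) `K2E3GL2ModCentre`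
import Mathlib.Topology.UrysohnsLemma
import HarnessLib

/-!
# (road «GL₂-sc», brick (2E-b2) = B1 at N = 2) Finiteness of the conjugation-fibre integral on `G_Λ = GL₂(F) ⧸ Λ·1`, HYPOTHESIS-FIRST on (2E-b1)

Cell `hodgecm-mathlib`, Track B, line `K2_E3_EllipticInputs`; road «GL₂-sc» = the payer of the hosted leaf socket (S-C′-GL₂sc) `sig_K2E3GL2SupercuspidalCharLocInt`
(U12 ED. 24; road owner K2E5-p17 (g5), BRICK LIST v1.1 `K2/K2E5-p17/g5/BRICKLIST-GL2sc-v1.1.K2E5-p17-g5.md`; dealer K2E3-plan (g4) D73 → K2E3-p11 (g6), 2026-09-04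
09:18Z).  This is the `N = 2` twin of ★ (B1) `K2E3GL3FinConjModCocompact` (K2E3-p23 (g5)), square roots of unity instead of cube roots, typed HYPOTHESIS-FIRST on the
head of (2E-b1) `K2E3GL2FinConjAdmissible.finConjGL_cc` (K2E3-p21 (g6), D72; itself hypothesis-first on (2E-a5) `K2E3GL2FinConj`), carried as the binder `hcc`
in exactly the shape of ★ B1⁰ `K2E3GL3FinConjAdmissible.finConjGL_cc` with `Fin 3 ↦ Fin 2` (∀ Borel structure and Haar measure on `Ḡ = GL₂(F) ⧸ Z`).

For a closed cocompact `Λ ≤ F^×` put `G_Λ := GL₂(F) ⧸ Λ·1` (★ 2F-b) and let `q_Λ : G_Λ → Ḡ` be the projection (continuous, surjective, proper; `μ.map q_Λ` is a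
Haar measure of `Ḡ`, ★ 2F-b).  THE THEOREM: for a Haar measure `μ` on `G_Λ`, `C ⊆ G_Λ` compact and `β : G_Λ → [0, Mb]` with compact `tsupport`,

  **`∫⁻_{C ∩ {g : Z_{G_Λ}(g) compact}} ∫⁻_{G_Λ} β(x g x⁻¹) dμ(x) dμ(g) < ⊤`**, given `hcc` (Harish-Chandra's finiteness on `Ḡ`).

PROOF (★ B1 verbatim).  (§1) If `Z_{G_Λ}(g)` is compact then so is `Z_Ḡ(q_Λ g)`: `ȳ = q_Λ y` centralising `q_Λ g` satisfies `g y = y g · (c·1)` with `c² = 1`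
(determinant of the lifted scalar commutator, `det (c·1) = c²`), and for each of the finitely many square roots of unity `c` the twisted commutant
`{y | g y = y g (c·1)}` is empty or a translate of `Z_{G_Λ}(g)` (★ B1 §1, generic, imported).  (§2 = ★ B1 §2, generic, imported) change of variables along
`q_Λ`.  (§3) Dominate `β ≤ β̄ ∘ q_Λ` with `β̄ := Mb · χ̄`, `χ̄` a Urysohn bump equal to `1` on `q_Λ(tsupport β)`, and apply `hcc` to `(μ.map q_Λ, q_Λ(C), β̄)`.
(§4) **`finConjModCocompact`** — the same finiteness over the road-«FC» domain `C ∩ {g : ∫⁻ β(x g x⁻¹) dμ < ⊤}` (`β` continuous): there the fibre integral equals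
`1_{Z compact} · fibre` (★ F2 `isCompact_centralizer_of_lintegral_conj_lt_top` at `G_Λ`, unimodular by ★ 2F-b′).

* §1 `val_det_scalar`, `exists_sq_eq_one_of_quotMap_commute`, `preimage_centralizer_quotMap_subset`, `finite_setOf_sq_eq_one`, **`isCompact_centralizer_quotMap`**.
* §2 **`finConjModCocompact_cc`** (compact-centraliser domain), §3 **`finConjModCocompact`** (road-«FC» domain) — both conditional on `hcc` only.

HONEST LABEL: HC_CM is proved only modulo the 7 printed citations (2 remaining named inputs: hLiu418 = stmt-HodgeConjecture-24832, h413 =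
stmt-HodgeConjecture-24833) until rung 0 closes; count-neutral (kernel lane `--supports stmt-HodgeConjecture-24833 --as helper`), THEOREMS ONLY; CONDITIONAL on the
binder `hcc` (OPEN: (2E-b1) ∘ (2E-a5)).

References: Harish-Chandra (van Dijk) 1970, Part VII §2–§3 (finiteness of the fibre integral; the passage `G → G ⧸ Z`) [cite: HarishChandra1970, Part VII §3 p. 70];
Weil 1965, integration on quotients by compact normal subgroups [cite: WeilIntegration1965, §7]; Folland 1995 §2.6 [cite: Folland1995, §2.6].
-/

open MeasureTheory MeasureTheory.Measure Set Function Filter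
open scoped NNReal ENNReal MatrixGroups Pointwise WithZero Valued Topology
open Matrix
open Literature.NumberTheory.Automorphic Literature.NumberTheory.GaloisRepresentations Literature.NumberTheory.GaloisRepresentations.IsNonarchimedeanLocalField
open Summit.HodgeConjecture.HodgeConjecture.Cruxes.H413.K2E3GL2ModCentre Summit.HodgeConjecture.HodgeConjecture.Cruxes.H413.K2E3GL2ModCocompactCentral
open Summit.HodgeConjecture.HodgeConjecture.Cruxes.H413.K2E3GL3FinConjModCocompact (setOf_twistedComm_eq_image isCompact_setOf_twistedComm
  lintegral_conj_le_lintegral_conj_map setLIntegral_comp_le_setLIntegral_map measurable_lintegral_conj)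

set_option linter.dupNamespace false

namespace Summit.HodgeConjecture.HodgeConjecture.Cruxes.H413.K2E3GL2FinConjModCocompact

/-! ## §1 Centralisers along `q_Λ : G_Λ → Ḡ` (`N = 2`: square roots of unity) -/

section Algebra

variable {F : Type*} [Field F] (Λ₀ : Subgroup Fˣ) [(Λ₀.map (Matrix.GeneralLinearGroup.scalar (Fin 2))).Normal]
  (hle : Λ₀.map (Matrix.GeneralLinearGroup.scalar (Fin 2)) ≤ (Subgroup.center (GL (Fin 2) F)).comap (MonoidHom.id (GL (Fin 2) F)))

/-- `det (c·1) = c²` in `GL₂`. [folklore] -/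
theorem val_det_scalar (c : Fˣ) : ((Matrix.GeneralLinearGroup.det (Matrix.GeneralLinearGroup.scalar (Fin 2) c) : Fˣ) : F) = (c : F) ^ 2 := by
  rw [Matrix.GeneralLinearGroup.val_det_apply, Matrix.GeneralLinearGroup.coe_scalar, Matrix.scalar_apply, Matrix.det_diagonal, Finset.prod_const,
    Finset.card_univ, Fintype.card_fin]

/-- **If `q_Λ y` commutes with `q_Λ g` then `g y = y g (c·1)` for a square root of unity `c`**: the lifted commutator is a scalar of determinant `1`.
[cite: HarishChandra1970, Part VII §3 p. 70] -/
theorem exists_sq_eq_one_of_quotMap_commute {y g : GL (Fin 2) F ⧸ Λ₀.map (Matrix.GeneralLinearGroup.scalar (Fin 2))}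
    (h : QuotientGroup.map _ (Subgroup.center (GL (Fin 2) F)) (MonoidHom.id (GL (Fin 2) F)) hle y *
        QuotientGroup.map _ (Subgroup.center (GL (Fin 2) F)) (MonoidHom.id (GL (Fin 2) F)) hle g =
      QuotientGroup.map _ (Subgroup.center (GL (Fin 2) F)) (MonoidHom.id (GL (Fin 2) F)) hle g *
        QuotientGroup.map _ (Subgroup.center (GL (Fin 2) F)) (MonoidHom.id (GL (Fin 2) F)) hle y) :
    ∃ c : Fˣ, c ^ 2 = 1 ∧
      g * y = y * g * (QuotientGroup.mk (Matrix.GeneralLinearGroup.scalar (Fin 2) c) : GL (Fin 2) F ⧸ Λ₀.map (Matrix.GeneralLinearGroup.scalar (Fin 2))) := by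
  obtain ⟨y', rfl⟩ := QuotientGroup.mk_surjective y
  obtain ⟨g', rfl⟩ := QuotientGroup.mk_surjective g
  rw [quotMap_mk Λ₀ hle, quotMap_mk Λ₀ hle, ← QuotientGroup.mk_mul, ← QuotientGroup.mk_mul] at h
  obtain ⟨c, hc⟩ := exists_scalar_of_mk_eq h
  refine ⟨c, ?_, ?_⟩
  · have hdet := congrArg Matrix.GeneralLinearGroup.det hc
    rw [map_mul, map_mul, map_mul, mul_comm (Matrix.GeneralLinearGroup.det g') (Matrix.GeneralLinearGroup.det y')] at hdet
    have h1 : Matrix.GeneralLinearGroup.det y' * Matrix.GeneralLinearGroup.det g' * Matrix.GeneralLinearGroup.det (Matrix.GeneralLinearGroup.scalar (Fin 2) c) =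
        Matrix.GeneralLinearGroup.det y' * Matrix.GeneralLinearGroup.det g' * 1 := by rw [mul_one]; exact hdet.symm
    have h2 := mul_left_cancel h1
    refine Units.ext ?_
    rw [Units.val_pow_eq_pow_val, ← val_det_scalar, h2, Units.val_one]
  · rw [← QuotientGroup.mk_mul, ← QuotientGroup.mk_mul, ← QuotientGroup.mk_mul, hc]

/-- `q_Λ⁻¹(Z_Ḡ(q_Λ g)) ⊆ ⋃_{c² = 1} {y | g y = y g (c·1)}`. [cite: HarishChandra1970, Part VII §3 p. 70] -/
theorem preimage_centralizer_quotMap_subset (g : GL (Fin 2) F ⧸ Λ₀.map (Matrix.GeneralLinearGroup.scalar (Fin 2))) :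
    (QuotientGroup.map _ (Subgroup.center (GL (Fin 2) F)) (MonoidHom.id (GL (Fin 2) F)) hle) ⁻¹'
        ((Subgroup.centralizer ({QuotientGroup.map _ (Subgroup.center (GL (Fin 2) F)) (MonoidHom.id (GL (Fin 2) F)) hle g} :
          Set (GL (Fin 2) F ⧸ Subgroup.center (GL (Fin 2) F)))) : Set (GL (Fin 2) F ⧸ Subgroup.center (GL (Fin 2) F))) ⊆
      ⋃ c ∈ {c : Fˣ | c ^ 2 = 1}, {y : GL (Fin 2) F ⧸ Λ₀.map (Matrix.GeneralLinearGroup.scalar (Fin 2)) |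
        g * y = y * g * (QuotientGroup.mk (Matrix.GeneralLinearGroup.scalar (Fin 2) c) : GL (Fin 2) F ⧸ Λ₀.map (Matrix.GeneralLinearGroup.scalar (Fin 2)))} := by
  intro y hy
  rw [Set.mem_preimage, SetLike.mem_coe, Subgroup.mem_centralizer_singleton_iff] at hy
  obtain ⟨c, hc2, hc⟩ := exists_sq_eq_one_of_quotMap_commute Λ₀ hle hy
  exact Set.mem_biUnion hc2 hc

omit [(Λ₀.map (Matrix.GeneralLinearGroup.scalar (Fin 2))).Normal] in
/-- The square roots of unity of a field form a finite set. [folklore] -/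
theorem finite_setOf_sq_eq_one : ({c : Fˣ | c ^ 2 = 1} : Set Fˣ).Finite := by
  have h : ({c : Fˣ | c ^ 2 = 1} : Set Fˣ) = ((rootsOfUnity 2 F : Subgroup Fˣ) : Set Fˣ) := by
    ext c; rw [mem_setOf_eq, SetLike.mem_coe, mem_rootsOfUnity]
  rw [h]
  exact Set.finite_coe_iff.1 (inferInstanceAs (Finite (rootsOfUnity 2 F)))

end Algebra

section Topology

variable {F : Type*} [Field F] [ValuativeRel F] [TopologicalSpace F] [IsNonarchimedeanLocalField F]
  (Λ₀ : Subgroup Fˣ) [(Λ₀.map (Matrix.GeneralLinearGroup.scalar (Fin 2))).Normal]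
  (hle : Λ₀.map (Matrix.GeneralLinearGroup.scalar (Fin 2)) ≤ (Subgroup.center (GL (Fin 2) F)).comap (MonoidHom.id (GL (Fin 2) F)))

/-- **CENTRALISER COMPARISON along `q_Λ`** (`N = 2`): if `Z_{G_Λ}(g)` is compact then `Z_Ḡ(q_Λ g)` is compact — it is closed and contained in the image of the
finite union of the compact twisted commutants `{y | g y = y g (c·1)}`, `c² = 1`. [cite: HarishChandra1970, Part VII §3 p. 70] -/
theorem isCompact_centralizer_quotMap (g : GL (Fin 2) F ⧸ Λ₀.map (Matrix.GeneralLinearGroup.scalar (Fin 2)))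
    (hg : IsCompact ((Subgroup.centralizer ({g} : Set (GL (Fin 2) F ⧸ Λ₀.map (Matrix.GeneralLinearGroup.scalar (Fin 2))))) :
      Set (GL (Fin 2) F ⧸ Λ₀.map (Matrix.GeneralLinearGroup.scalar (Fin 2))))) :
    IsCompact ((Subgroup.centralizer ({QuotientGroup.map _ (Subgroup.center (GL (Fin 2) F)) (MonoidHom.id (GL (Fin 2) F)) hle g} :
      Set (GL (Fin 2) F ⧸ Subgroup.center (GL (Fin 2) F)))) : Set (GL (Fin 2) F ⧸ Subgroup.center (GL (Fin 2) F))) := by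
  haveI : T2Space (GL (Fin 2) F ⧸ Subgroup.center (GL (Fin 2) F)) := t2Space_quot F
  have hS : IsCompact (⋃ c ∈ {c : Fˣ | c ^ 2 = 1}, {y : GL (Fin 2) F ⧸ Λ₀.map (Matrix.GeneralLinearGroup.scalar (Fin 2)) |
      g * y = y * g * (QuotientGroup.mk (Matrix.GeneralLinearGroup.scalar (Fin 2) c) : GL (Fin 2) F ⧸ Λ₀.map (Matrix.GeneralLinearGroup.scalar (Fin 2)))}) :=
    (finite_setOf_sq_eq_one (F := F)).isCompact_biUnion fun c _ => isCompact_setOf_twistedComm hg _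
  have hcl : IsClosed ((Subgroup.centralizer ({QuotientGroup.map _ (Subgroup.center (GL (Fin 2) F)) (MonoidHom.id (GL (Fin 2) F)) hle g} :
      Set (GL (Fin 2) F ⧸ Subgroup.center (GL (Fin 2) F)))) : Set (GL (Fin 2) F ⧸ Subgroup.center (GL (Fin 2) F))) := by
    have heq : ((Subgroup.centralizer ({QuotientGroup.map _ (Subgroup.center (GL (Fin 2) F)) (MonoidHom.id (GL (Fin 2) F)) hle g} :
        Set (GL (Fin 2) F ⧸ Subgroup.center (GL (Fin 2) F)))) : Set (GL (Fin 2) F ⧸ Subgroup.center (GL (Fin 2) F))) =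
        {k | k * QuotientGroup.map _ (Subgroup.center (GL (Fin 2) F)) (MonoidHom.id (GL (Fin 2) F)) hle g =
          QuotientGroup.map _ (Subgroup.center (GL (Fin 2) F)) (MonoidHom.id (GL (Fin 2) F)) hle g * k} :=
      Set.ext fun k => Subgroup.mem_centralizer_singleton_iff
    rw [heq]
    exact isClosed_eq (continuous_id.mul continuous_const) (continuous_const.mul continuous_id)
  refine (hS.image (continuous_quotMap Λ₀ hle)).of_isClosed_subset hcl ?_
  intro k hk
  obtain ⟨y, rfl⟩ := surjective_quotMap Λ₀ hle k
  exact ⟨y, preimage_centralizer_quotMap_subset Λ₀ hle g hk, rfl⟩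

end Topology

/-! ## §2 `finConjModCocompact_cc`, hypothesis-first on (2E-b1) `finConjGL_cc` -/

section Main

/-- **(road «GL₂-sc», 2E-b2 = B1 at `N = 2`) FINITENESS OF THE CONJUGATION-FIBRE INTEGRAL ON `G_Λ = GL₂(F) ⧸ Λ·1`, COMPACT-CENTRALISER DOMAIN, HYPOTHESIS-FIRST.**
`F` a non-archimedean local field, `Λ ≤ F^×` with `F^× ⧸ Λ` compact, `μ` a Haar measure on `G_Λ`, `C ⊆ G_Λ` compact, `β : G_Λ → [0, Mb]` with compact
`tsupport` (`Mb < ∞`; no continuity needed), and `hcc` = (2E-b1) `finConjGL_cc` at `N = 2` (★ B1⁰'s statement with `Fin 3 ↦ Fin 2`, ∀ Borel structure ∕ Haar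
measure on `Ḡ`): `∫⁻_{C ∩ {g : Z_{G_Λ}(g) compact}} ∫⁻ β(x g x⁻¹) dμ(x) dμ(g) < ⊤` — `hcc` transported along `q_Λ` (§1 centraliser comparison, ★ B1 §2 change of
variables, Urysohn domination `β ≤ Mb·χ̄ ∘ q_Λ`). [cite: HarishChandra1970, Part VII §3 p. 70] [cite: WeilIntegration1965, §7] -/
theorem finConjModCocompact_cc {F : Type*} [Field F] [ValuativeRel F] [TopologicalSpace F] [IsNonarchimedeanLocalField F]
    (hcc : ∀ [MeasurableSpace (GL (Fin 2) F ⧸ Subgroup.center (GL (Fin 2) F))] [BorelSpace (GL (Fin 2) F ⧸ Subgroup.center (GL (Fin 2) F))]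
      (ν : Measure (GL (Fin 2) F ⧸ Subgroup.center (GL (Fin 2) F))) [ν.IsHaarMeasure]
      {C : Set (GL (Fin 2) F ⧸ Subgroup.center (GL (Fin 2) F))}, IsCompact C →
      ∀ {β : (GL (Fin 2) F ⧸ Subgroup.center (GL (Fin 2) F)) → ℝ≥0∞}, Continuous β → IsCompact (tsupport β) →
      ∀ {Mb : ℝ≥0∞}, Mb ≠ ⊤ → (∀ g, β g ≤ Mb) →
      ∫⁻ g in C ∩ {h : GL (Fin 2) F ⧸ Subgroup.center (GL (Fin 2) F) | IsCompact ((Subgroup.centralizer ({h} : Set (GL (Fin 2) F ⧸ Subgroup.center (GL (Fin 2) F)))) :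
          Set (GL (Fin 2) F ⧸ Subgroup.center (GL (Fin 2) F)))}, ∫⁻ x, β (x * g * x⁻¹) ∂ν ∂ν < ⊤)
    (Λ₀ : Subgroup Fˣ) [(Λ₀.map (Matrix.GeneralLinearGroup.scalar (Fin 2))).Normal] [CompactSpace (Fˣ ⧸ Λ₀)]
    [MeasurableSpace (GL (Fin 2) F ⧸ Λ₀.map (Matrix.GeneralLinearGroup.scalar (Fin 2)))] [BorelSpace (GL (Fin 2) F ⧸ Λ₀.map (Matrix.GeneralLinearGroup.scalar (Fin 2)))]
    (μ : Measure (GL (Fin 2) F ⧸ Λ₀.map (Matrix.GeneralLinearGroup.scalar (Fin 2)))) [μ.IsHaarMeasure]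
    {C : Set (GL (Fin 2) F ⧸ Λ₀.map (Matrix.GeneralLinearGroup.scalar (Fin 2)))} (hC : IsCompact C)
    {β : (GL (Fin 2) F ⧸ Λ₀.map (Matrix.GeneralLinearGroup.scalar (Fin 2))) → ℝ≥0∞} (hβs : IsCompact (tsupport β))
    {Mb : ℝ≥0∞} (hMb : Mb ≠ ⊤) (hβM : ∀ g, β g ≤ Mb) :
    ∫⁻ g in C ∩ {h : GL (Fin 2) F ⧸ Λ₀.map (Matrix.GeneralLinearGroup.scalar (Fin 2)) |
        IsCompact ((Subgroup.centralizer ({h} : Set (GL (Fin 2) F ⧸ Λ₀.map (Matrix.GeneralLinearGroup.scalar (Fin 2))))) :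
          Set (GL (Fin 2) F ⧸ Λ₀.map (Matrix.GeneralLinearGroup.scalar (Fin 2))))},
      ∫⁻ x, β (x * g * x⁻¹) ∂μ ∂μ < ⊤ := by
  -- §0 frame: `GL₂(F)`, `Ḡ`, the projection `q := q_Λ`, the Haar measure `μ̄ := μ.map q`
  haveI : SecondCountableTopology (GL (Fin 2) F) := secondCountableTopology_gl2 F
  haveI : LocallyCompactSpace (GL (Fin 2) F) := locallyCompactSpace_gl2 F
  haveI : T2Space (GL (Fin 2) F ⧸ Subgroup.center (GL (Fin 2) F)) := t2Space_quot F
  haveI : SigmaCompactSpace (GL (Fin 2) F ⧸ Subgroup.center (GL (Fin 2) F)) := sigmaCompactSpace_of_locallyCompact_secondCountable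
  letI : MeasurableSpace (GL (Fin 2) F ⧸ Subgroup.center (GL (Fin 2) F)) := borel _
  haveI : BorelSpace (GL (Fin 2) F ⧸ Subgroup.center (GL (Fin 2) F)) := ⟨rfl⟩
  have hle : Λ₀.map (Matrix.GeneralLinearGroup.scalar (Fin 2)) ≤ (Subgroup.center (GL (Fin 2) F)).comap (MonoidHom.id (GL (Fin 2) F)) :=
    map_scalar_le_comap_center Λ₀
  set q : GL (Fin 2) F ⧸ Λ₀.map (Matrix.GeneralLinearGroup.scalar (Fin 2)) →* GL (Fin 2) F ⧸ Subgroup.center (GL (Fin 2) F) :=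
    QuotientGroup.map _ (Subgroup.center (GL (Fin 2) F)) (MonoidHom.id (GL (Fin 2) F)) hle with hq
  have hqc : Continuous q := continuous_quotMap Λ₀ hle
  have hqm : Measurable q := hqc.measurable
  haveI : (μ.map q).IsHaarMeasure := isHaarMeasure_map_quotMap Λ₀ hle μ
  -- §1 the dominating bump `β̄ = Mb · χ̄` on `Ḡ`, `χ̄ = 1` on `q(tsupport β)`
  obtain ⟨χ, hχ1, -, hχcs, hχ01⟩ := exists_continuous_one_zero_of_isCompact (hβs.image hqc) isClosed_empty (Set.disjoint_empty _)
  obtain ⟨βb, hβb⟩ : ∃ βb : (GL (Fin 2) F ⧸ Subgroup.center (GL (Fin 2) F)) → ℝ≥0∞, ∀ y, βb y = ENNReal.ofReal (Mb.toReal * χ y) := ⟨_, fun _ => rfl⟩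
  have hβbf : βb = fun y => ENNReal.ofReal (Mb.toReal * χ y) := funext hβb
  have hβbc : Continuous βb := by rw [hβbf]; exact ENNReal.continuous_ofReal.comp (continuous_const.mul χ.continuous)
  have hβbs : IsCompact (tsupport βb) := by
    rw [hβbf]
    exact ((hχcs.mul_left (f := fun _ => Mb.toReal)).comp_left ENNReal.ofReal_zero).isCompact
  have hβbM : ∀ y, βb y ≤ Mb := fun y => by
    rw [hβb]
    calc ENNReal.ofReal (Mb.toReal * χ y) ≤ ENNReal.ofReal Mb.toReal :=
          ENNReal.ofReal_le_ofReal (mul_le_of_le_one_right ENNReal.toReal_nonneg (hχ01 y).2)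
      _ = Mb := ENNReal.ofReal_toReal hMb
  have hdom : ∀ y, β y ≤ βb (q y) := fun y => by
    by_cases hy : y ∈ tsupport β
    · have h1 : χ (q y) = 1 := hχ1 (Set.mem_image_of_mem q hy)
      rw [hβb, h1, mul_one, ENNReal.ofReal_toReal hMb]
      exact hβM y
    · rw [image_eq_zero_of_notMem_tsupport hy]; exact bot_le
  -- §2 fibre comparison and the domain inclusion (§1 centraliser comparison)
  have hW : ∀ g, ∫⁻ x, β (x * g * x⁻¹) ∂μ ≤ ∫⁻ x', βb (x' * q g * x'⁻¹) ∂(μ.map q) := fun g =>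
    lintegral_conj_le_lintegral_conj_map q hqm μ hβbc hdom g
  have hWm : Measurable fun g' : GL (Fin 2) F ⧸ Subgroup.center (GL (Fin 2) F) => ∫⁻ x', βb (x' * g' * x'⁻¹) ∂(μ.map q) :=
    measurable_lintegral_conj (μ.map q) hβbc
  have hsub : C ∩ {h : GL (Fin 2) F ⧸ Λ₀.map (Matrix.GeneralLinearGroup.scalar (Fin 2)) |
      IsCompact ((Subgroup.centralizer ({h} : Set (GL (Fin 2) F ⧸ Λ₀.map (Matrix.GeneralLinearGroup.scalar (Fin 2))))) :
        Set (GL (Fin 2) F ⧸ Λ₀.map (Matrix.GeneralLinearGroup.scalar (Fin 2))))} ⊆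
      q ⁻¹' (q '' C ∩ {h : GL (Fin 2) F ⧸ Subgroup.center (GL (Fin 2) F) |
        IsCompact ((Subgroup.centralizer ({h} : Set (GL (Fin 2) F ⧸ Subgroup.center (GL (Fin 2) F)))) : Set (GL (Fin 2) F ⧸ Subgroup.center (GL (Fin 2) F)))}) :=
    fun g hg => ⟨Set.mem_image_of_mem q hg.1, isCompact_centralizer_quotMap Λ₀ hle g hg.2⟩
  -- §3 `hcc` on `Ḡ`
  calc ∫⁻ g in C ∩ {h : GL (Fin 2) F ⧸ Λ₀.map (Matrix.GeneralLinearGroup.scalar (Fin 2)) |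
          IsCompact ((Subgroup.centralizer ({h} : Set (GL (Fin 2) F ⧸ Λ₀.map (Matrix.GeneralLinearGroup.scalar (Fin 2))))) :
            Set (GL (Fin 2) F ⧸ Λ₀.map (Matrix.GeneralLinearGroup.scalar (Fin 2))))}, ∫⁻ x, β (x * g * x⁻¹) ∂μ ∂μ
      ≤ ∫⁻ g in C ∩ {h : GL (Fin 2) F ⧸ Λ₀.map (Matrix.GeneralLinearGroup.scalar (Fin 2)) |
          IsCompact ((Subgroup.centralizer ({h} : Set (GL (Fin 2) F ⧸ Λ₀.map (Matrix.GeneralLinearGroup.scalar (Fin 2))))) :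
            Set (GL (Fin 2) F ⧸ Λ₀.map (Matrix.GeneralLinearGroup.scalar (Fin 2))))}, ∫⁻ x', βb (x' * q g * x'⁻¹) ∂(μ.map q) ∂μ :=
        lintegral_mono fun g => hW g
    _ ≤ ∫⁻ g' in q '' C ∩ {h : GL (Fin 2) F ⧸ Subgroup.center (GL (Fin 2) F) |
          IsCompact ((Subgroup.centralizer ({h} : Set (GL (Fin 2) F ⧸ Subgroup.center (GL (Fin 2) F)))) : Set (GL (Fin 2) F ⧸ Subgroup.center (GL (Fin 2) F)))},
          ∫⁻ x', βb (x' * g' * x'⁻¹) ∂(μ.map q) ∂(μ.map q) :=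
        setLIntegral_comp_le_setLIntegral_map μ hqm hWm hsub
    _ < ⊤ := hcc (μ.map q) (hC.image hqc) hβbc hβbs hMb hβbM

end Main

/-! ## §3 The road-«FC» domain `C ∩ {fibre < ⊤}` — `finConjModCocompact` -/

section Phi

/-- **(road «GL₂-sc», 2E-b2-Φ = B1-Φ at `N = 2`) FINITENESS OF THE CONJUGATION-FIBRE INTEGRAL ON `G_Λ`, ROAD-«FC» DOMAIN, HYPOTHESIS-FIRST** (`F` of characteristic
`0` with uniformizer `ϖ`, `Λ ≤ F^×` closed with `F^× ⧸ Λ` compact, `β : G_Λ → [0, Mb]` continuous with compact support, `hcc` = (2E-b1) at `N = 2`):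
`∫⁻_{C ∩ {g : ∫⁻ β(xgx⁻¹) dμ < ⊤}} ∫⁻ β(x g x⁻¹) dμ(x) dμ(g) < ⊤`.  On the domain, `W(g) ≠ 0` forces `β(x g x⁻¹) ≠ 0` for some `x`, hence `Z_{G_Λ}(g)` compact (★ F2,
`G_Λ` unimodular ★ 2F-b′); so `W ≤ 1_{Zc}·W` there and `∫⁻_C 1_{Zc} W ≤ ∫⁻_{C ∩ Zc} W < ⊤` (§2). [cite: HarishChandra1970, Part VII §3 p. 70] [cite: Folland1995, §2.6] -/
theorem finConjModCocompact {F : Type*} [Field F] [Valued F ℤᵐ⁰] [ValuativeRel F] [(Valued.v : Valuation F ℤᵐ⁰).Compatible] [IsNonarchimedeanLocalField F]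
    {ϖ : F} (hϖ : Valued.v ϖ = WithZero.exp (-1 : ℤ))
    (hcc : ∀ [MeasurableSpace (GL (Fin 2) F ⧸ Subgroup.center (GL (Fin 2) F))] [BorelSpace (GL (Fin 2) F ⧸ Subgroup.center (GL (Fin 2) F))]
      (ν : Measure (GL (Fin 2) F ⧸ Subgroup.center (GL (Fin 2) F))) [ν.IsHaarMeasure]
      {C : Set (GL (Fin 2) F ⧸ Subgroup.center (GL (Fin 2) F))}, IsCompact C →
      ∀ {β : (GL (Fin 2) F ⧸ Subgroup.center (GL (Fin 2) F)) → ℝ≥0∞}, Continuous β → IsCompact (tsupport β) →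
      ∀ {Mb : ℝ≥0∞}, Mb ≠ ⊤ → (∀ g, β g ≤ Mb) →
      ∫⁻ g in C ∩ {h : GL (Fin 2) F ⧸ Subgroup.center (GL (Fin 2) F) | IsCompact ((Subgroup.centralizer ({h} : Set (GL (Fin 2) F ⧸ Subgroup.center (GL (Fin 2) F)))) :
          Set (GL (Fin 2) F ⧸ Subgroup.center (GL (Fin 2) F)))}, ∫⁻ x, β (x * g * x⁻¹) ∂ν ∂ν < ⊤)
    (Λ₀ : Subgroup Fˣ) [(Λ₀.map (Matrix.GeneralLinearGroup.scalar (Fin 2))).Normal] (hΛ : IsClosed (Λ₀ : Set Fˣ)) [CompactSpace (Fˣ ⧸ Λ₀)]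
    [MeasurableSpace (GL (Fin 2) F ⧸ Λ₀.map (Matrix.GeneralLinearGroup.scalar (Fin 2)))] [BorelSpace (GL (Fin 2) F ⧸ Λ₀.map (Matrix.GeneralLinearGroup.scalar (Fin 2)))]
    (μ : Measure (GL (Fin 2) F ⧸ Λ₀.map (Matrix.GeneralLinearGroup.scalar (Fin 2)))) [μ.IsHaarMeasure]
    {C : Set (GL (Fin 2) F ⧸ Λ₀.map (Matrix.GeneralLinearGroup.scalar (Fin 2)))} (hC : IsCompact C)
    {β : (GL (Fin 2) F ⧸ Λ₀.map (Matrix.GeneralLinearGroup.scalar (Fin 2))) → ℝ≥0∞} (hβ : Continuous β) (hβs : IsCompact (tsupport β))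
    {Mb : ℝ≥0∞} (hMb : Mb ≠ ⊤) (hβM : ∀ g, β g ≤ Mb) :
    ∫⁻ g in C ∩ {g : GL (Fin 2) F ⧸ Λ₀.map (Matrix.GeneralLinearGroup.scalar (Fin 2)) | ∫⁻ x, β (x * g * x⁻¹) ∂μ < ⊤}, ∫⁻ x, β (x * g * x⁻¹) ∂μ ∂μ < ⊤ := by
  -- §0 frame: `G_Λ` Hausdorff, second countable, locally compact, σ-compact, unimodular
  haveI : SecondCountableTopology (GL (Fin 2) F) := secondCountableTopology_gl2 F
  haveI : LocallyCompactSpace (GL (Fin 2) F) := locallyCompactSpace_gl2 F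
  haveI : T2Space (GL (Fin 2) F ⧸ Λ₀.map (Matrix.GeneralLinearGroup.scalar (Fin 2))) := t2Space_quotScalar Λ₀ hΛ
  haveI : SigmaCompactSpace (GL (Fin 2) F ⧸ Λ₀.map (Matrix.GeneralLinearGroup.scalar (Fin 2))) := sigmaCompactSpace_of_locallyCompact_secondCountable
  haveI : μ.IsMulRightInvariant := K2E3GL2ModCocompactUnimodular.isMulRightInvariant_quotScalar_of_isHaarMeasure Λ₀ hΛ hϖ μ
  set Zc : Set (GL (Fin 2) F ⧸ Λ₀.map (Matrix.GeneralLinearGroup.scalar (Fin 2))) :=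
    {h | IsCompact ((Subgroup.centralizer ({h} : Set (GL (Fin 2) F ⧸ Λ₀.map (Matrix.GeneralLinearGroup.scalar (Fin 2))))) :
      Set (GL (Fin 2) F ⧸ Λ₀.map (Matrix.GeneralLinearGroup.scalar (Fin 2))))} with hZc
  -- §1 the domain is measurable; on it `W ≤ 1_{Zc} · W` (★ F2)
  have hWm : Measurable fun g : GL (Fin 2) F ⧸ Λ₀.map (Matrix.GeneralLinearGroup.scalar (Fin 2)) => ∫⁻ x, β (x * g * x⁻¹) ∂μ :=
    measurable_lintegral_conj μ hβ
  have hAm : MeasurableSet (C ∩ {g : GL (Fin 2) F ⧸ Λ₀.map (Matrix.GeneralLinearGroup.scalar (Fin 2)) | ∫⁻ x, β (x * g * x⁻¹) ∂μ < ⊤}) :=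
    hC.isClosed.measurableSet.inter (measurableSet_lt hWm measurable_const)
  have hpt : ∀ g ∈ C ∩ {g : GL (Fin 2) F ⧸ Λ₀.map (Matrix.GeneralLinearGroup.scalar (Fin 2)) | ∫⁻ x, β (x * g * x⁻¹) ∂μ < ⊤},
      ∫⁻ x, β (x * g * x⁻¹) ∂μ ≤ Zc.indicator (fun g => ∫⁻ x, β (x * g * x⁻¹) ∂μ) g := by
    intro g hg
    by_cases hex : ∃ x, β (x * g * x⁻¹) ≠ 0
    · obtain ⟨x, hx⟩ := hex
      have hgZ : g ∈ Zc := K2E3FinConjFibreReduction.isCompact_centralizer_of_lintegral_conj_lt_top μ hβ hg.2 hx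
      rw [Set.indicator_of_mem hgZ]
    · push Not at hex
      have h0 : ∫⁻ x, β (x * g * x⁻¹) ∂μ = 0 := by simp [hex]
      rw [h0]; exact bot_le
  -- §2 `∫⁻_{C ∩ Φ} W ≤ ∫⁻_C 1_{Zc} W ≤ ∫⁻_{C ∩ Zc} W < ⊤` (§2 `finConjModCocompact_cc`)
  calc ∫⁻ g in C ∩ {g : GL (Fin 2) F ⧸ Λ₀.map (Matrix.GeneralLinearGroup.scalar (Fin 2)) | ∫⁻ x, β (x * g * x⁻¹) ∂μ < ⊤}, ∫⁻ x, β (x * g * x⁻¹) ∂μ ∂μ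
      ≤ ∫⁻ g in C ∩ {g : GL (Fin 2) F ⧸ Λ₀.map (Matrix.GeneralLinearGroup.scalar (Fin 2)) | ∫⁻ x, β (x * g * x⁻¹) ∂μ < ⊤},
          Zc.indicator (fun g => ∫⁻ x, β (x * g * x⁻¹) ∂μ) g ∂μ := lintegral_mono_ae (ae_restrict_of_forall_mem hAm hpt)
    _ ≤ ∫⁻ g in C, Zc.indicator (fun g => ∫⁻ x, β (x * g * x⁻¹) ∂μ) g ∂μ := lintegral_mono_set Set.inter_subset_left
    _ ≤ ∫⁻ g in Zc, ∫⁻ x, β (x * g * x⁻¹) ∂μ ∂(μ.restrict C) := lintegral_indicator_le _ _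
    _ = ∫⁻ g in C ∩ Zc, ∫⁻ x, β (x * g * x⁻¹) ∂μ ∂μ := by rw [Measure.restrict_restrict' hC.isClosed.measurableSet, Set.inter_comm]
    _ < ⊤ := finConjModCocompact_cc (fun ν _ C hC β hβ hβs Mb hMb hβM => hcc ν hC hβ hβs hMb hβM) Λ₀ μ hC hβs hMb hβM

end Phi

end Summit.HodgeConjecture.HodgeConjecture.Cruxes.H413.K2E3GL2FinConjModCocompact
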